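import Mathlib
import HarnessLib
import Literature.Combinatorics.Additive.KempermanElementaryPairs
import Literature.Combinatorics.Additive.PuncturedGroupCriticalPairs

/-!
# Critical pairs whose sum is the whole group are Kemperman pairs

[cite: Kemperman1960, Lemma 5.2; Lemma 4.6] [tag: critical-pair] [tag: inverse-theorem]

Topic `Literature/Combinatorics/Additive`.  Cell `mm-stpp` (D-0046), seat `mm-stpp-lit` (gen 22); the
second bottom case of the «only if» half of the Kemperman Structure Theorem (companion of
`PuncturedGroupCriticalPairs.lean`): pairs with `A + B = G`, to which the branch «`A + B` periodic
with a unique expression element» of Theorem 5.1 reduces inside the stabiliser of `A + B`.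

SOURCE.  J. H. B. Kemperman, *On small sumsets in an abelian group*, Acta Math. **103** (1960)
63–88: proof of Lemma 5.2, case (i) (p. 79 = p0017 of the held text `paper:doi-10-1007-bf02546525`:
«Suppose that `A + B` is a coset of some finite group `H`. Then `A + B` is periodic, thus, from (2),
there exists an element `c₀` with `ν_{c₀}(A, B) = 1`. If no other such element exists `(A, B)` is
elementary of type (III). Otherwise, from Lemma 4.6, either `(A, B)` is elementary of type (II) or
`P₁(A, B)` is non-empty.») and Lemma 4.6 (i) (p. 77: «`A + B = c₀ + K`, while `ν_{c₁}(A, B) = 1`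
for some `c₁ ≠ c₀` … Then either both `A` and `B` are in arithmetic progression of difference
`d = c₁ − c₀` or `P₁(A, B)` is non-empty»).

MAIN RESULT.  `exists_isKempermanDecompI_of_add_eq_univ`: `G` finite nontrivial, `A + B = G`,
`|A + B| = |A| + |B| − 1`, `ν_{c₀}(A, B) = 1` ⟹ `∃ H A₁ A₀ B₁ B₀, IsKempermanDecompI H A B A₁ A₀ B₁ B₀`.
0 named facts; everything PROVED.

PROOF (ours; no `P₁` machinery).  A unique expression element `c` of a pair with `|A| + |B| =
|G| + 1` means `A ∪ (c − B) = G` with `A ∩ (c − B)` a single point (`shape_of_unique`).  With ONE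
unique expression element `c₀ = a₀ + b₀` the pair is of type (III) with `H = G`.  With TWO, `c₀` and
`c₁ = c₀ + k`: `B = c₀ − (Ā ∪ {a₀})` and `c₁ − Ā ⊆ B` give `x ∈ A, x ≠ a₀ ⟹ x + k ∈ A` and
`y ∈ B, y ≠ b₀ ⟹ y + k ∈ B` (`add_mem_A`, `add_mem_B`); hence `A ∖ (a₀ + ⟨k⟩)`, `B ∖ (b₀ + ⟨k⟩)` are
`⟨k⟩`-periodic (`periodic_A_sdiff`, `periodic_B_sdiff`), the parts in the two cosets are progressions
with difference `k` with their only exits at `a₀`, `b₀` (`isAP_of_exit_unique`: at most one exit ⟹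
`c_k ≤ 1` ⟹ full coset or, by `IsQuasiProgression.exists_isQuasiPeriodicDecomp`, a progression) of
total size `≤ ord k + 1` — type (I)/(II) (`elementary_full`) —, a sum `a + b ≡ c₀ (mod ⟨k⟩)` has
`a ≡ a₀` since otherwise `c₀ − b ∉ A` would lie in the periodic part through `a` (`quot_unique_full`),
and `|φ(A)| + |φ(B)| = (|φ(A ∖ C₀)| + 1) + (|φ(Ā ∖ C₀)| + 1) = ([G:⟨k⟩] − 1) + 2` (`cosetCount_full`).

Also: `addConvolution_eq_card_inter_image` (`ν_c(A,B) = |A ∩ (c − B)|`), `isAP_of_exit_unique`.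

## References
* J. H. B. Kemperman, *On small sumsets in an abelian group*, Acta Math. 103 (1960) 63–88,
  doi:10.1007/BF02546525 — Lemma 4.6 p. 77, Lemma 5.2 (proof, case (i)) p. 79 (held
  `paper:doi-10-1007-bf02546525`, p0015/p0017 read 2026-08-29) [cite: Kemperman1960, Lemma 5.2].
* D. J. Grynkiewicz, *A step beyond Kemperman's structure theorem*, Mathematika 55 (2009) 67–114, §2
  (quasi-progressions; elementary pairs of type (III)) [cite: Grynkiewicz2009, §2].
-/

namespace Literature.Combinatorics.Additive

open Finset
open scoped Pointwise

variable {G : Type*} [AddCommGroup G] [DecidableEq G]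

/-! ### A unique expression element of a pair with `|A| + |B| = |G| + 1` -/

/-- `r_{A,B}(c) = |A ∩ (c − B)|`. [cite: Kemperman1960, §3] -/
theorem addConvolution_eq_card_inter_image (A B : Finset G) (c : G) :
    A.addConvolution B c = #(A ∩ B.image fun b => c - b) := by
  rw [Grynkiewicz2009.addConvolution_comm, addConvolution_eq_card_filter]
  congr 1
  ext a
  simp only [mem_filter, mem_inter, mem_image]
  constructor
  · rintro ⟨ha, hb⟩; exact ⟨ha, c - a, hb, sub_sub_cancel c a⟩
  · rintro ⟨ha, b, hb, rfl⟩; rw [sub_sub_cancel]; exact ⟨ha, hb⟩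

section FullGroup

variable [Fintype G] {A B : Finset G} {c₀ c₁ a₀ k : G}

/-- If `|A| + |B| = |G| + 1` and `c` has a unique expression `c = a + b`, then `A ∪ (c − B) = G`,
i.e. `c − x ∈ B` for every `x ∉ A`, and `B = c − (Ā ∪ {a})`. [cite: Kemperman1960, Lemma 4.6 (proof)] -/
theorem shape_of_unique (hAB : #A + #B = Fintype.card G + 1) {c : G} (hc : A.addConvolution B c = 1) :
    ∃ a ∈ A, c - a ∈ B ∧ ∀ y, y ∈ B ↔ (c - y ∉ A ∨ c - y = a) := by
  obtain ⟨b, hb, hbA, huniq⟩ := addConvolution_eq_one_iff.1 hc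
  refine ⟨c - b, hbA, by rw [sub_sub_cancel]; exact hb, fun y => ?_⟩
  have hunion : A ∪ B.image (fun b => c - b) = univ := by
    apply eq_univ_of_card
    have h1 := card_union_add_card_inter A (B.image fun b => c - b)
    rw [← addConvolution_eq_card_inter_image, hc,
      card_image_of_injective _ (fun x y (h : c - x = c - y) => sub_right_injective h)] at h1
    have := card_le_univ (A ∪ B.image fun b => c - b)
    omega
  constructor
  · intro hy
    by_cases h : c - y ∈ A
    · right
      have := huniq y hy h
      rw [this]
    · exact Or.inl h
  · rintro (h | h)
    · have : c - y ∈ A ∪ B.image (fun b => c - b) := by rw [hunion]; exact mem_univ _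
      rw [mem_union, mem_image] at this
      rcases this with h' | ⟨b', hb', he⟩
      · exact absurd h' h
      · have : b' = y := sub_right_injective he
        rw [← this]; exact hb'
    · have : y = b := by
        have := sub_sub_cancel c y
        rw [h] at this
        rw [← this, sub_sub_cancel]
      rw [this]; exact hb

/-! ### Two unique expression elements: the decomposition with quasi-period `⟨c₁ − c₀⟩` -/

omit [DecidableEq G] [Fintype G] in
/-- Data of the two-unique-expression case: `B = c₀ − (Ā ∪ {a₀})` and `c₁ − x ∈ B` for `x ∉ A`,
`k = c₁ − c₀`.  Then `y ∈ B ⟹ y + k ∈ B` unless `c₀ − y = a₀`: [cite: Kemperman1960, Lemma 4.6] -/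
private theorem add_mem_B (hB : ∀ y, y ∈ B ↔ (c₀ - y ∉ A ∨ c₀ - y = a₀))
    (hB1 : ∀ x, x ∉ A → c₁ - x ∈ B) (hk : k = c₁ - c₀) {y : G} (hy : y ∈ B) (hya : c₀ - y ≠ a₀) :
    y + k ∈ B := by
  have hz : c₀ - y ∉ A := ((hB y).1 hy).resolve_right hya
  have := hB1 _ hz
  have e : c₁ - (c₀ - y) = y + k := by rw [hk]; abel
  rwa [e] at this

omit [DecidableEq G] [Fintype G] in
/-- … and `x ∈ A ⟹ x + k ∈ A` unless `x = a₀`. [cite: Kemperman1960, Lemma 4.6] -/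
private theorem add_mem_A (hB : ∀ y, y ∈ B ↔ (c₀ - y ∉ A ∨ c₀ - y = a₀))
    (hB1 : ∀ x, x ∉ A → c₁ - x ∈ B) (hk : k = c₁ - c₀) {x : G} (hx : x ∈ A) (hxa : x ≠ a₀) :
    x + k ∈ A := by
  by_contra hxk
  have h1 := hB1 _ hxk
  have e : c₁ - (x + k) = c₀ - x := by rw [hk]; abel
  rw [e] at h1
  rcases (hB _).1 h1 with h | h
  · exact h (by rw [sub_sub_cancel]; exact hx)
  · exact hxa (by rw [sub_sub_cancel] at h; exact h)

omit [Fintype G] in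
/-- A finite set closed under `x ↦ x + k` is `⟨k⟩`-periodic. [cite: Grynkiewicz2009, §2] -/
private theorem isPeriodicWith_of_forall_add_mem {X : Finset G} (h : ∀ x ∈ X, x + k ∈ X) :
    IsPeriodicWith (AddSubgroup.zmultiples k) X := by
  apply isPeriodicWith_zmultiples_of_vadd_eq
  apply eq_of_subset_of_card_le
  · intro y hy
    obtain ⟨x, hx, rfl⟩ := mem_vadd_finset.1 hy
    rw [vadd_eq_add, add_comm]; exact h x hx
  · rw [card_vadd_finset]

omit [Fintype G] in
/-- The part of `A` outside the coset `a₀ + ⟨k⟩` is `⟨k⟩`-periodic. [cite: Kemperman1960, Lemma 4.6] -/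
private theorem periodic_A_sdiff (hB : ∀ y, y ∈ B ↔ (c₀ - y ∉ A ∨ c₀ - y = a₀))
    (hB1 : ∀ x, x ∉ A → c₁ - x ∈ B) (hk : k = c₁ - c₀) {Kf : Finset G}
    (hKf : ∀ g, g ∈ Kf ↔ g ∈ AddSubgroup.zmultiples k) :
    IsPeriodicWith (AddSubgroup.zmultiples k) (A \ (a₀ +ᵥ Kf)) := by
  refine isPeriodicWith_of_forall_add_mem fun x hx => ?_
  rw [mem_sdiff] at hx ⊢
  have hxa : x ≠ a₀ := by
    rintro rfl
    exact hx.2 (mem_vadd_finset.2 ⟨0, (hKf 0).2 (AddSubgroup.zero_mem _), by rw [vadd_eq_add, add_zero]⟩)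
  refine ⟨add_mem_A hB hB1 hk hx.1 hxa, fun h => hx.2 ?_⟩
  obtain ⟨z, hz, he⟩ := mem_vadd_finset.1 h
  refine mem_vadd_finset.2 ⟨z - k, (hKf _).2 (AddSubgroup.sub_mem _ ((hKf z).1 hz)
    (AddSubgroup.mem_zmultiples k)), ?_⟩
  rw [vadd_eq_add] at he ⊢
  have : x = a₀ + z - k := by rw [he, add_sub_cancel_right]
  rw [this]; abel

omit [Fintype G] in
/-- The part of `B` outside the coset `c₀ − a₀ + ⟨k⟩` is `⟨k⟩`-periodic. [cite: Kemperman1960, Lemma 4.6] -/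
private theorem periodic_B_sdiff (hB : ∀ y, y ∈ B ↔ (c₀ - y ∉ A ∨ c₀ - y = a₀))
    (hB1 : ∀ x, x ∉ A → c₁ - x ∈ B) (hk : k = c₁ - c₀) {Kf : Finset G}
    (hKf : ∀ g, g ∈ Kf ↔ g ∈ AddSubgroup.zmultiples k) :
    IsPeriodicWith (AddSubgroup.zmultiples k) (B \ ((c₀ - a₀) +ᵥ Kf)) := by
  refine isPeriodicWith_of_forall_add_mem fun y hy => ?_
  rw [mem_sdiff] at hy ⊢
  have hya : c₀ - y ≠ a₀ := by
    intro h
    exact hy.2 (mem_vadd_finset.2 ⟨0, (hKf 0).2 (AddSubgroup.zero_mem _), by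
      rw [vadd_eq_add, add_zero, ← h, sub_sub_cancel]⟩)
  refine ⟨add_mem_B hB hB1 hk hy.1 hya, fun h => hy.2 ?_⟩
  obtain ⟨z, hz, he⟩ := mem_vadd_finset.1 h
  refine mem_vadd_finset.2 ⟨z - k, (hKf _).2 (AddSubgroup.sub_mem _ ((hKf z).1 hz)
    (AddSubgroup.mem_zmultiples k)), ?_⟩
  rw [vadd_eq_add] at he ⊢
  have : y = c₀ - a₀ + z - k := by rw [he, add_sub_cancel_right]
  rw [this]; abel

end FullGroup

section FullGroup2

variable [Fintype G] {A B : Finset G} {c₀ c₁ a₀ k : G}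

/-- `|φ_H(X)| + |φ_H(G ∖ X)| = |φ_H(G)|` for an `H`-periodic `X`. [cite: Kemperman1960, §5] -/
private theorem cosetCount_add_compl' {H' : AddSubgroup G} {X : Finset G} (hX : IsPeriodicWith H' X) :
    cosetCount H' X + cosetCount H' Xᶜ = cosetCount H' (univ : Finset G) := by
  rw [← cosetCount_union, union_compl]
  intro x hx y hy hxy
  rw [mem_compl] at hy
  refine hy ?_
  have := hX.add_mem (H'.neg_mem hxy) hx
  rwa [neg_sub, sub_add_cancel] at this

/-- A nonempty subset of one `⟨k⟩`-coset with at most one «exit» (an `x ∈ X` with `x + k ∉ X`) is an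
arithmetic progression with difference `k` (a full coset or a quasi-progression inside one coset).
[cite: Kemperman1960, Lemma 4.6] [cite: Grynkiewicz2009, §2] -/
theorem isAP_of_exit_unique {X : Finset G} {k e : G} (hne : X.Nonempty)
    (hcos : ∀ x ∈ X, ∀ y ∈ X, x - y ∈ AddSubgroup.zmultiples k)
    (hexit : ∀ x ∈ X, x + k ∉ X → x = e) : IsAP X k := by
  have hle : componentCount k X ≤ 1 := by
    rw [componentCount_eq_card_vadd_sdiff]
    refine card_le_one.2 fun u hu v hv => ?_
    rw [mem_sdiff, mem_vadd_finset] at hu hv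
    obtain ⟨⟨x, hx, rfl⟩, hxk⟩ := hu
    obtain ⟨y, ⟨hy, rfl⟩⟩ := hv.1
    rw [vadd_eq_add, add_comm] at hxk
    have hvk := hv.2; rw [vadd_eq_add, add_comm] at hvk
    rw [hexit x hx hxk, hexit y hy hvk]
  -- the carrier finset of `⟨k⟩` and the coset of `X`
  set Kf := apFinset (0 : G) k (addOrderOf k)
  have hKf : ∀ g, g ∈ Kf ↔ g ∈ AddSubgroup.zmultiples k := fun g => by
    rw [← mem_coe, ← Isoperimetric.coe_zmultiples_eq_coe_apFinset k, SetLike.mem_coe]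
  obtain ⟨x₀, hx₀⟩ := hne
  have hXsub : X ⊆ x₀ +ᵥ Kf := subset_vadd_carrier_of_sub_mem hKf fun x hx => hcos x hx x₀ hx₀
  have hcoset : x₀ +ᵥ Kf = apFinset x₀ k (addOrderOf k) := by rw [vadd_apFinset, add_zero]
  have hn : #(apFinset x₀ k (addOrderOf k)) = addOrderOf k :=
    Isoperimetric.card_apFinset_of_le_addOrderOf _ _ le_rfl
  rcases Nat.le_one_iff_eq_zero_or_eq_one.1 hle with h0 | h1
  · -- periodic: the full coset
    have hper : IsPeriodicWith (AddSubgroup.zmultiples k) X :=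
      isPeriodicWith_zmultiples_of_vadd_eq (componentCount_eq_zero_iff.1 h0)
    have hXeq : X = x₀ +ᵥ Kf := by
      refine hXsub.antisymm fun y hy => ?_
      obtain ⟨z, hz, rfl⟩ := mem_vadd_finset.1 hy
      rw [vadd_eq_add, add_comm]; exact hper.add_mem ((hKf z).1 hz) hx₀
    refine ⟨x₀, ?_⟩
    rw [hXeq, hcoset, hn]
  · obtain ⟨X₁, X₀, hd, hAP, hX₀ne⟩ := IsQuasiProgression.exists_isQuasiPeriodicDecomp h1
    -- `X₁ = ∅`: a nonempty periodic part inside the coset would be the whole coset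
    have hX₁ : X₁ = ∅ := by
      by_contra hne1
      obtain ⟨x₁, hx₁⟩ := nonempty_iff_ne_empty.2 hne1
      obtain ⟨y, hy⟩ := hX₀ne
      have hyx : y - x₁ ∈ AddSubgroup.zmultiples k := hcos y (hd.right_subset hy) x₁ (hd.left_subset hx₁)
      have : y ∈ X₁ := by
        have := hd.periodic.add_mem hyx hx₁; rwa [sub_add_cancel] at this
      exact disjoint_left.1 hd.disjoint this hy
    have hX : X₀ = X := by
      have := hd.union_eq; rwa [hX₁, empty_union] at this
    rw [← hX]; exact hAP

omit [Fintype G] in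
/-- Condition (i) in the two-unique-expression case: a sum `a + b ≡ c₀ (mod ⟨k⟩)` forces `a ≡ a₀`.
[cite: Kemperman1960, Thm 5.1 (ii); Lemma 4.6] -/
private theorem quot_unique_full (hB : ∀ y, y ∈ B ↔ (c₀ - y ∉ A ∨ c₀ - y = a₀))
    (hB1 : ∀ x, x ∉ A → c₁ - x ∈ B) (hk : k = c₁ - c₀) {Kf : Finset G}
    (hKf : ∀ g, g ∈ Kf ↔ g ∈ AddSubgroup.zmultiples k) :
    ∀ a ∈ A, ∀ b ∈ B, ∀ a' ∈ A ∩ (a₀ +ᵥ Kf), ∀ b' ∈ B ∩ ((c₀ - a₀) +ᵥ Kf),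
      (a + b) - (a' + b') ∈ AddSubgroup.zmultiples k →
        a - a' ∈ AddSubgroup.zmultiples k ∧ b - b' ∈ AddSubgroup.zmultiples k := by
  set K := AddSubgroup.zmultiples k
  intro a ha b hb a' ha' b' hb' hq
  obtain ⟨u, hu, hua⟩ := mem_vadd_finset.1 (mem_inter.1 ha').2
  obtain ⟨v, hv, hvb⟩ := mem_vadd_finset.1 (mem_inter.1 hb').2
  have huK := (hKf u).1 hu
  have hvK := (hKf v).1 hv
  -- `a + b ≡ c₀ (mod K)`
  have hc : a + b - c₀ ∈ K := by
    have e : a + b - c₀ = (a + b - (a' + b')) + u + v := by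
      rw [← hua, ← hvb, vadd_eq_add, vadd_eq_add]; abel
    rw [e]; exact K.add_mem (K.add_mem hq huK) hvK
  -- `a ≡ a₀ (mod K)`
  have haa₀ : a - a₀ ∈ K := by
    by_contra hnot
    have haout : a ∈ A \ (a₀ +ᵥ Kf) := by
      refine mem_sdiff.2 ⟨ha, fun h => hnot ?_⟩
      obtain ⟨z, hz, rfl⟩ := mem_vadd_finset.1 h
      rw [vadd_eq_add, add_sub_cancel_left]; exact (hKf z).1 hz
    -- `z = c₀ − b ∉ A` (it is `≡ a`, not `a₀`) but lies in the periodic part containing `a`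
    have hzA : c₀ - b ∉ A := by
      rcases (hB b).1 hb with h | h
      · exact h
      · exfalso; apply hnot
        have e : a - a₀ = (a + b - c₀) := by rw [← h]; abel
        rw [e]; exact hc
    have hper := periodic_A_sdiff hB hB1 hk hKf
    have : c₀ - b ∈ A \ (a₀ +ᵥ Kf) := by
      have e : c₀ - b = -(a + b - c₀) + a := by abel
      rw [e]; exact hper.add_mem (K.neg_mem hc) haout
    exact hzA (mem_sdiff.1 this).1
  refine ⟨?_, ?_⟩
  · have e : a - a' = (a - a₀) - u := by rw [← hua, vadd_eq_add]; abel
    rw [e]; exact K.sub_mem haa₀ huK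
  · have e : b - b' = (a + b - c₀) - (a - a₀) - v := by rw [← hvb, vadd_eq_add]; abel
    rw [e]; exact K.sub_mem (K.sub_mem hc haa₀) hvK

/-- Condition (ii) in the two-unique-expression case. [cite: Kemperman1960, Thm 5.1 (iv)] -/
private theorem cosetCount_full (hsum : A + B = univ) (ha₀ : a₀ ∈ A) (hb₀ : c₀ - a₀ ∈ B)
    (hB : ∀ y, y ∈ B ↔ (c₀ - y ∉ A ∨ c₀ - y = a₀))
    (hB1 : ∀ x, x ∉ A → c₁ - x ∈ B) (hk : k = c₁ - c₀) (hk0 : k ≠ 0) {Kf : Finset G}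
    (hKf : ∀ g, g ∈ Kf ↔ g ∈ AddSubgroup.zmultiples k) :
    cosetCount (AddSubgroup.zmultiples k) (A + B) + 1 =
      cosetCount (AddSubgroup.zmultiples k) A + cosetCount (AddSubgroup.zmultiples k) B := by
  set K := AddSubgroup.zmultiples k
  have hKb : K ≠ ⊥ := by rwa [Ne, AddSubgroup.zmultiples_eq_bot]
  have memK : ∀ {z}, z ∈ Kf → z ∈ K := fun hz => (hKf _).1 hz
  have hperA := periodic_A_sdiff hB hB1 hk hKf
  have hperB := periodic_B_sdiff hB hB1 hk hKf
  have hdA : IsQuasiPeriodicDecomp K A (A \ (a₀ +ᵥ Kf)) (A ∩ (a₀ +ᵥ Kf)) :=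
    ⟨hKb, disjoint_sdiff_inter _ _, sdiff_union_inter _ _, hperA, fun x hx y hy => by
      obtain ⟨u, hu, rfl⟩ := mem_vadd_finset.1 (mem_inter.1 hx).2
      obtain ⟨v, hv, rfl⟩ := mem_vadd_finset.1 (mem_inter.1 hy).2
      rw [vadd_eq_add, vadd_eq_add, add_sub_add_left_eq_sub]; exact K.sub_mem (memK hu) (memK hv)⟩
  have hdB : IsQuasiPeriodicDecomp K B (B \ ((c₀ - a₀) +ᵥ Kf)) (B ∩ ((c₀ - a₀) +ᵥ Kf)) :=
    ⟨hKb, disjoint_sdiff_inter _ _, sdiff_union_inter _ _, hperB, fun x hx y hy => by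
      obtain ⟨u, hu, rfl⟩ := mem_vadd_finset.1 (mem_inter.1 hx).2
      obtain ⟨v, hv, rfl⟩ := mem_vadd_finset.1 (mem_inter.1 hy).2
      rw [vadd_eq_add, vadd_eq_add, add_sub_add_left_eq_sub]; exact K.sub_mem (memK hu) (memK hv)⟩
  have cA := hdA.cosetCount_eq ⟨a₀, mem_inter.2 ⟨ha₀, mem_vadd_finset.2 ⟨0, (hKf 0).2 K.zero_mem,
    by rw [vadd_eq_add, add_zero]⟩⟩⟩
  have cB := hdB.cosetCount_eq ⟨c₀ - a₀, mem_inter.2 ⟨hb₀, mem_vadd_finset.2 ⟨0, (hKf 0).2 K.zero_mem,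
    by rw [vadd_eq_add, add_zero]⟩⟩⟩
  -- `B ∖ (c₀ − a₀ + K) = c₀ − (Ā ∖ (a₀ + K))`
  have hBeq : B \ ((c₀ - a₀) +ᵥ Kf) = (Aᶜ \ (a₀ +ᵥ Kf)).image fun x => c₀ - x := by
    ext y
    rw [mem_sdiff, mem_image, hB]
    constructor
    · rintro ⟨h1, h2⟩
      have hne : c₀ - y ≠ a₀ := fun h => h2 (mem_vadd_finset.2 ⟨0, (hKf 0).2 K.zero_mem, by
        rw [vadd_eq_add, add_zero, ← h, sub_sub_cancel]⟩)
      refine ⟨c₀ - y, mem_sdiff.2 ⟨mem_compl.2 (h1.resolve_right hne), fun h => h2 ?_⟩, sub_sub_cancel _ _⟩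
      obtain ⟨z, hz, he⟩ := mem_vadd_finset.1 h
      refine mem_vadd_finset.2 ⟨-z, (hKf _).2 (K.neg_mem (memK hz)), ?_⟩
      rw [vadd_eq_add] at he ⊢
      have : y = c₀ - (a₀ + z) := by rw [he, sub_sub_cancel]
      rw [this]; abel
    · rintro ⟨x, hx, rfl⟩
      rw [mem_sdiff, mem_compl] at hx
      rw [sub_sub_cancel]
      refine ⟨Or.inl hx.1, fun h => hx.2 ?_⟩
      obtain ⟨z, hz, he⟩ := mem_vadd_finset.1 h
      refine mem_vadd_finset.2 ⟨-z, (hKf _).2 (K.neg_mem (memK hz)), ?_⟩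
      rw [vadd_eq_add] at he ⊢
      have : x = c₀ - (c₀ - a₀ + z) := by rw [he, sub_sub_cancel]
      rw [this]; abel
  have cB1 : cosetCount K (B \ ((c₀ - a₀) +ᵥ Kf)) = cosetCount K (Aᶜ \ (a₀ +ᵥ Kf)) := by
    rw [hBeq, cosetCount_image_const_sub]
  -- the two periodic parts tile the complement of the coset `a₀ + K`
  have hC₀per : IsPeriodicWith K (a₀ +ᵥ Kf) := isPeriodicWith_vadd_carrier hKf a₀
  have csplit : cosetCount K (A \ (a₀ +ᵥ Kf)) + cosetCount K (Aᶜ \ (a₀ +ᵥ Kf)) =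
      cosetCount K (a₀ +ᵥ Kf)ᶜ := by
    rw [← cosetCount_union]
    · congr 1; ext x; simp only [mem_union, mem_sdiff, mem_compl]; tauto
    · intro x hx y hy hxy
      have : y ∈ A \ (a₀ +ᵥ Kf) := by
        have := hperA.add_mem (K.neg_mem hxy) hx; rwa [neg_sub, sub_add_cancel] at this
      exact (mem_compl.1 (mem_sdiff.1 hy).1) (mem_sdiff.1 this).1
  have ccomp := cosetCount_add_compl' hC₀per
  rw [cosetCount_eq_one_of_sub_mem ⟨a₀, mem_vadd_finset.2 ⟨0, (hKf 0).2 K.zero_mem, by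
    rw [vadd_eq_add, add_zero]⟩⟩ (fun x hx y hy => by
      obtain ⟨u, hu, rfl⟩ := mem_vadd_finset.1 hx
      obtain ⟨v, hv, rfl⟩ := mem_vadd_finset.1 hy
      rw [vadd_eq_add, vadd_eq_add, add_sub_add_left_eq_sub]; exact K.sub_mem (memK hu) (memK hv))] at ccomp
  rw [hsum, cA, cB, cB1]
  omega

/-- Condition (iv) in the two-unique-expression case: the bottom pair consists of two progressions
with difference `k` (each with its only exit at `a₀`, resp. `c₀ − a₀`) of total size `≤ ord k + 1`.
[cite: Kemperman1960, Lemma 4.6 («both A and B are in arithmetic progression of difference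
d = c₁ − c₀»)] -/
private theorem elementary_full (ha₀ : a₀ ∈ A) (hb₀ : c₀ - a₀ ∈ B)
    (hB : ∀ y, y ∈ B ↔ (c₀ - y ∉ A ∨ c₀ - y = a₀))
    (hB1 : ∀ x, x ∉ A → c₁ - x ∈ B) (hk : k = c₁ - c₀) {Kf : Finset G}
    (hKf : ∀ g, g ∈ Kf ↔ g ∈ AddSubgroup.zmultiples k) :
    IsElementaryPair (A ∩ (a₀ +ᵥ Kf)) (B ∩ ((c₀ - a₀) +ᵥ Kf)) := by
  set K := AddSubgroup.zmultiples k
  have memK : ∀ {z}, z ∈ Kf → z ∈ K := fun hz => (hKf _).1 hz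
  have h0Kf : (0 : G) ∈ Kf := (hKf 0).2 K.zero_mem
  have hkKf : ∀ {z}, z ∈ Kf → z + k ∈ Kf := fun hz =>
    (hKf _).2 (K.add_mem (memK hz) (AddSubgroup.mem_zmultiples k))
  set A₀ := A ∩ (a₀ +ᵥ Kf)
  set B₀ := B ∩ ((c₀ - a₀) +ᵥ Kf)
  have ha₀A₀ : a₀ ∈ A₀ := mem_inter.2 ⟨ha₀, mem_vadd_finset.2 ⟨0, h0Kf, by rw [vadd_eq_add, add_zero]⟩⟩
  have hb₀B₀ : c₀ - a₀ ∈ B₀ :=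
    mem_inter.2 ⟨hb₀, mem_vadd_finset.2 ⟨0, h0Kf, by rw [vadd_eq_add, add_zero]⟩⟩
  have cosA : ∀ x ∈ A₀, ∀ y ∈ A₀, x - y ∈ K := fun x hx y hy => by
    obtain ⟨u, hu, rfl⟩ := mem_vadd_finset.1 (mem_inter.1 hx).2
    obtain ⟨v, hv, rfl⟩ := mem_vadd_finset.1 (mem_inter.1 hy).2
    rw [vadd_eq_add, vadd_eq_add, add_sub_add_left_eq_sub]; exact K.sub_mem (memK hu) (memK hv)
  have cosB : ∀ x ∈ B₀, ∀ y ∈ B₀, x - y ∈ K := fun x hx y hy => by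
    obtain ⟨u, hu, rfl⟩ := mem_vadd_finset.1 (mem_inter.1 hx).2
    obtain ⟨v, hv, rfl⟩ := mem_vadd_finset.1 (mem_inter.1 hy).2
    rw [vadd_eq_add, vadd_eq_add, add_sub_add_left_eq_sub]; exact K.sub_mem (memK hu) (memK hv)
  -- the only exits
  have exitA : ∀ x ∈ A₀, x + k ∉ A₀ → x = a₀ := by
    intro x hx hxk
    by_contra hxa
    obtain ⟨u, hu, hux⟩ := mem_vadd_finset.1 (mem_inter.1 hx).2
    refine hxk (mem_inter.2 ⟨add_mem_A hB hB1 hk (mem_inter.1 hx).1 hxa, mem_vadd_finset.2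
      ⟨u + k, hkKf hu, by rw [← hux, vadd_eq_add, vadd_eq_add, add_assoc]⟩⟩)
  have exitB : ∀ y ∈ B₀, y + k ∉ B₀ → y = c₀ - a₀ := by
    intro y hy hyk
    by_contra hya
    have hya' : c₀ - y ≠ a₀ := fun h => hya (by rw [← h, sub_sub_cancel])
    obtain ⟨u, hu, huy⟩ := mem_vadd_finset.1 (mem_inter.1 hy).2
    refine hyk (mem_inter.2 ⟨add_mem_B hB hB1 hk (mem_inter.1 hy).1 hya', mem_vadd_finset.2
      ⟨u + k, hkKf hu, by rw [← huy, vadd_eq_add, vadd_eq_add, add_assoc]⟩⟩)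
  have hAP_A : IsAP A₀ k := isAP_of_exit_unique ⟨a₀, ha₀A₀⟩ cosA exitA
  have hAP_B : IsAP B₀ k := isAP_of_exit_unique ⟨_, hb₀B₀⟩ cosB exitB
  -- sizes: `B₀ ⊆ c₀ − ((a₀ + Kf) ∖ A₀ ∪ {a₀})`
  have hKf' : Kf = apFinset (0 : G) k (addOrderOf k) := by
    ext g
    rw [hKf, ← mem_coe, ← Isoperimetric.coe_zmultiples_eq_coe_apFinset k, SetLike.mem_coe]
  have hKcard : #Kf = addOrderOf k := by
    rw [hKf']; exact Isoperimetric.card_apFinset_of_le_addOrderOf _ _ le_rfl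
  have hsize : #A₀ + #B₀ ≤ addOrderOf k + 1 := by
    have hsub : B₀.image (fun y => c₀ - y) ⊆ ((a₀ +ᵥ Kf) \ A₀) ∪ {a₀} := by
      intro x hx
      obtain ⟨y, hy, rfl⟩ := mem_image.1 hx
      obtain ⟨hyB, hyc⟩ := mem_inter.1 hy
      obtain ⟨u, hu, huy⟩ := mem_vadd_finset.1 hyc
      have hcos : c₀ - y ∈ a₀ +ᵥ Kf := mem_vadd_finset.2 ⟨-u, (hKf _).2 (K.neg_mem (memK hu)), by
        rw [← huy, vadd_eq_add, vadd_eq_add]; abel⟩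
      rw [mem_union, mem_sdiff, mem_singleton]
      rcases (hB y).1 hyB with h | h
      · exact Or.inl ⟨hcos, fun h' => h (mem_inter.1 h').1⟩
      · exact Or.inr h
    have h1 := card_le_card hsub
    rw [card_image_of_injective _ (fun x y (h : c₀ - x = c₀ - y) => sub_right_injective h)] at h1
    have h2 := card_union_le ((a₀ +ᵥ Kf) \ A₀) ({a₀} : Finset G)
    rw [card_singleton, card_sdiff_of_subset inter_subset_right, card_vadd_finset, hKcard] at h2
    have h3 : #A₀ ≤ addOrderOf k := by
      have := card_le_card (inter_subset_right : A₀ ⊆ a₀ +ᵥ Kf)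
      rwa [card_vadd_finset, hKcard] at this
    have hd : #(A ∩ (a₀ +ᵥ Kf)) = #A₀ := rfl
    rw [hd] at h2
    omega
  by_cases h1 : #A₀ = 1 ∨ #B₀ = 1
  · exact Or.inl ⟨⟨a₀, ha₀A₀⟩, ⟨_, hb₀B₀⟩, h1⟩
  · right; left
    have hA1 := card_pos.2 ⟨a₀, ha₀A₀⟩
    have hB1' := card_pos.2 ⟨_, hb₀B₀⟩
    refine ⟨by omega, by omega, k, hAP_A, hAP_B, Or.inr (by omega)⟩

end FullGroup2

section FullGroupMain

variable [Fintype G]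

/-- **Critical pairs whose sum is the whole group are Kemperman pairs** (Kemperman 1960, proof of
Lemma 5.2, case (i) «Suppose that `A + B` is a coset of some finite group `H`. Then `A + B` is
periodic, thus, from (2), there exists an element `c₀` with `ν_{c₀}(A, B) = 1`. If no other such
element exists `(A, B)` is elementary of type (III). Otherwise, from Lemma 4.6, either `(A, B)` is
elementary of type (II) or `P₁(A, B)` is non-empty», with `H = G`): `G` finite nontrivial,
`A + B = G`, `|A + B| = |A| + |B| − 1`, `ν_{c₀}(A, B) = 1` ⟹ a decomposition (i)–(iv)
(`IsKempermanDecompI`).  PROOF (ours, replacing Lemma 4.6 (i) / `P₁`): with a second unique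
expression element `c₁`, `k = c₁ − c₀`, `c₀ = a₀ + b₀`: `B = c₀ − (Ā ∪ {a₀})` and `c₁ − Ā ⊆ B`
(`shape_of_unique`), whence `A ∖ (a₀ + ⟨k⟩)` and `B ∖ (b₀ + ⟨k⟩)` are `⟨k⟩`-periodic
(`x ∈ A, x ≠ a₀ ⟹ x + k ∈ A`; `y ∈ B, y ≠ b₀ ⟹ y + k ∈ B`), the parts in the two cosets are
progressions with difference `k` (only exits `a₀`, `b₀`; `isAP_of_exit_unique`) of total size
`≤ ord k + 1` — type (I)/(II) —, a sum `≡ c₀ (mod ⟨k⟩)` forces `a ≡ a₀` (`quot_unique_full`), and the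
coset count is `[G:⟨k⟩] + 1` (`cosetCount_full`).  With exactly one unique expression element the pair
is of type (III) with `H = G`. [cite: Kemperman1960, Lemma 5.2 (proof, case (i)); Lemma 4.6] -/
theorem exists_isKempermanDecompI_of_add_eq_univ [Nontrivial G] {A B : Finset G}
    (hsum : A + B = univ) (hcrit : #(A + B) + 1 = #A + #B) {c₀ : G}
    (hc₀ : A.addConvolution B c₀ = 1) :
    ∃ (H : AddSubgroup G) (A₁ A₀ B₁ B₀ : Finset G), IsKempermanDecompI H A B A₁ A₀ B₁ B₀ := by
  have hAB : #A + #B = Fintype.card G + 1 := by rw [← hcrit, hsum, card_univ]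
  obtain ⟨a₀, ha₀, hb₀, hB⟩ := shape_of_unique hAB hc₀
  have hG : (⊤ : AddSubgroup G) ≠ ⊥ := by
    obtain ⟨x, y, hxy⟩ := exists_pair_ne G
    intro h
    have hx : x ∈ (⊤ : AddSubgroup G) := AddSubgroup.mem_top x
    have hy : y ∈ (⊤ : AddSubgroup G) := AddSubgroup.mem_top y
    rw [h, AddSubgroup.mem_bot] at hx hy
    exact hxy (by rw [hx, hy])
  by_cases h2 : ∃ c₁, c₁ ≠ c₀ ∧ A.addConvolution B c₁ = 1
  · obtain ⟨c₁, hc₁ne, hc₁⟩ := h2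
    obtain ⟨a₁, -, -, hB'⟩ := shape_of_unique hAB hc₁
    have hB1 : ∀ x, x ∉ A → c₁ - x ∈ B := fun x hx =>
      (hB' _).2 (Or.inl (by rw [sub_sub_cancel]; exact hx))
    have hk0 : c₁ - c₀ ≠ 0 := sub_ne_zero.2 hc₁ne
    set k := c₁ - c₀ with hk
    set K := AddSubgroup.zmultiples k
    have hKb : K ≠ ⊥ := by rwa [Ne, AddSubgroup.zmultiples_eq_bot]
    set Kf := apFinset (0 : G) k (addOrderOf k)
    have hKf : ∀ g, g ∈ Kf ↔ g ∈ K := fun g => by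
      rw [← mem_coe, ← Isoperimetric.coe_zmultiples_eq_coe_apFinset k, SetLike.mem_coe]
    have memK : ∀ {z}, z ∈ Kf → z ∈ K := fun hz => (hKf _).1 hz
    have h0 : (0 : G) ∈ Kf := (hKf 0).2 K.zero_mem
    refine ⟨K, A \ (a₀ +ᵥ Kf), A ∩ (a₀ +ᵥ Kf), B \ ((c₀ - a₀) +ᵥ Kf), B ∩ ((c₀ - a₀) +ᵥ Kf),
      { decomp_left := ⟨hKb, disjoint_sdiff_inter _ _, sdiff_union_inter _ _,
          periodic_A_sdiff hB hB1 hk hKf, fun x hx y hy => by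
            obtain ⟨u, hu, rfl⟩ := mem_vadd_finset.1 (mem_inter.1 hx).2
            obtain ⟨v, hv, rfl⟩ := mem_vadd_finset.1 (mem_inter.1 hy).2
            rw [vadd_eq_add, vadd_eq_add, add_sub_add_left_eq_sub]
            exact K.sub_mem (memK hu) (memK hv)⟩
        decomp_right := ⟨hKb, disjoint_sdiff_inter _ _, sdiff_union_inter _ _,
          periodic_B_sdiff hB hB1 hk hKf, fun x hx y hy => by
            obtain ⟨u, hu, rfl⟩ := mem_vadd_finset.1 (mem_inter.1 hx).2
            obtain ⟨v, hv, rfl⟩ := mem_vadd_finset.1 (mem_inter.1 hy).2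
            rw [vadd_eq_add, vadd_eq_add, add_sub_add_left_eq_sub]
            exact K.sub_mem (memK hu) (memK hv)⟩
        left_nonempty := ⟨a₀, mem_inter.2 ⟨ha₀, mem_vadd_finset.2 ⟨0, h0, by
          rw [vadd_eq_add, add_zero]⟩⟩⟩
        right_nonempty := ⟨c₀ - a₀, mem_inter.2 ⟨hb₀, mem_vadd_finset.2 ⟨0, h0, by
          rw [vadd_eq_add, add_zero]⟩⟩⟩
        quot_unique := quot_unique_full hB hB1 hk hKf
        cosetCount_add := cosetCount_full hsum ha₀ hb₀ hB hB1 hk hk0 hKf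
        elementary := elementary_full ha₀ hb₀ hB hB1 hk hKf }⟩
  · -- exactly one unique expression element: type (III) with `H = G`
    have huniq : ∀ x, A.addConvolution B x = 1 ↔ x = a₀ + (c₀ - a₀) := by
      intro x
      rw [add_sub_cancel]
      exact ⟨fun hx => by_contra fun hne => h2 ⟨x, hne, hx⟩, fun hx => by rw [hx]; exact hc₀⟩
    have hIII : IsElementaryIII A B :=
      ⟨⊤, a₀, c₀ - a₀, ha₀, hb₀, fun _ _ => AddSubgroup.mem_top _, fun _ _ => AddSubgroup.mem_top _,
        by rw [AddSubgroup.card_top, Nat.card_eq_fintype_card]; exact hAB, huniq⟩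
    have hE : IsElementaryPair A B := Or.inr (Or.inr (Or.inl hIII))
    exact ⟨⊤, ∅, A, ∅, B, hE.isKempermanDecompI_top hG⟩

end FullGroupMain

end Literature.Combinatorics.Additive
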